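import Literature.NumberTheory.Automorphic.Liu2021.Thm418ProofMapAsPrinted
import Literature.LinearAlgebra.BaseChange.NumberFieldLineEigenline
import Literature.NumberTheory.Automorphic.Liu2021.Map43Injective
import Literature.NumberTheory.Automorphic.Liu2021.Thm418ValueField
import HarnessLib

/-!
# [Liu 2021] proof of Theorem 4.18 — the map (4.3) over RATIONAL Betti carriers: clauses (i)(ii)(iii) as THEOREMS

Y. Liu, *Fourier–Jacobi cycles and arithmetic relative trace formula*, Camb. J. Math. **9** (2021) 1–147 = arXiv:2102.11518
[Liu2021]; `l. NNNN` = lines of the author's TeX `FJcycle.tex` (md5 `6db49a74122d2cb0f224fa1b39488a0c`), as in `Thm418AsPrinted` /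
`Thm418ProofMapAsPrinted`.  SEQUEL of the as-printed record `Thm418Data.Map43Data` / `Map43AsPrinted` (`Thm418ProofMapAsPrinted.lean`):
there the three sentences the proof of Thm. 4.18 prints about the map (4.3) «`z ⊗ f ↦ z · f^*α`» (l. 2247–2268) —
(i) «the maximal subspace of `H¹_{B,τ'}(A_μ, ℂ)` over which `M_μ` acts via the inclusion `M_μ ↪ ℂ` has dimension `1`» (l. 2250),
(ii) «pulling back `α` … is `ℂ[𝔾(𝔸_F^∞)]`-linear» (l. 2250), (iii) «(4.3) induces … an isomorphism» (l. 2254–2268) — are a PREDICATE on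
bare `ℂ`-carriers.  Here the SAME objects are typed over their rational forms, and the predicate becomes a THEOREM:

* ⟨CARRIER⟩ `U` = `H¹_{B,τ'}(A_∞, ℚ)` with its Hecke action `ρU` (§4.2 l. 2070–2081 with `ℚ`-coefficients, as in Lem. 2.4 (1) l. 1213),
  and the comparison `ι : ℂ ⊗_ℚ H¹_{B,τ'}(A_∞, ℚ) → H¹_{B,τ'}(A_∞, ℂ)` into the consumer's complex carrier `HB` (⟨LAW⟩ injective,
  `𝔾(𝔸_F^∞)`-equivariant — universal coefficients; the Hecke action is defined over `E`, l. 2074);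
* ⟨CARRIER⟩ `L` = `H¹_{B,τ'}(A_μ, ℚ)` as a module over `M_μ` through `i_μ : M_μ → End_E(A_μ)_ℚ` (Def. 4.5 (2), l. 1948), with ⟨LAW⟩
  `rank_L : finrank_{M_μ} L = 1` — «`A_μ` has dimension `[M_μ:ℚ]/2`» (l. 650) and `i_μ` is a CM structure, so `H¹(A_μ; ℚ)` (of
  `ℚ`-dimension `2 dim A_μ = [M_μ:ℚ]`) is an `M_μ`-line;
* the CHOICE «we choose a basis `α` of this subspace» (l. 2250): `α ∈ ℂ ⊗_ℚ L`, `α ≠ 0`, `(m • ·) ⊗ ℂ α = m · α`;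
* ⟨CARRIER⟩ `P : Ω(μ) →+ Hom_ℚ(H¹_{B,τ'}(A_μ, ℚ), H¹_{B,τ'}(A_∞, ℚ))`, `f ↦ f^*` on rational classes (Rem. 4.17 at `D_μ`, l. 2248), with
  ⟨LAW⟩s `P_smul` («`M_μ` acts via `i_μ`», l. 2219: `(i_μ(m) ∘ f)^* = f^* ∘ i_μ(m)^*`), `P_comm` (both `𝔾(𝔸_F^∞)`-actions come from `A_∞`,
  l. 2074 / 2219) and `P_injective` (faithfulness of rational `H¹` on homomorphisms of abelian varieties — a STATEMENT-level fact, the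
  input of the tree's `Liu2021/Map43Injective.lean`).

DEFINED: `toMap43Data` (the bare-`ℂ` record with `H¹_{B,τ'}(A_μ, ℂ) := ℂ ⊗_ℚ L`, `i_μ(m)^* := (m • ·) ⊗ ℂ`, `f^* := ι ∘ (P f ⊗ ℂ)`),
hence (4.3) `J` and «`f ↦ f^*α`» `pb` BY NAME from `Thm418ProofMapAsPrinted`; `J_tmul : J (z ⊗ f) = ι (z • (P f ⊗ ℂ) α)`.
PROVED: (ii) `pb_rhoΩ` and `hJ` (equivariance of (4.3) on all of `Ω(μ) ⊗ ℂ`, hypothesis-free); (i) `finrank_eigenline_eq_one`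
(hypothesis-free) — by the tree's `Literature.LinearAlgebra.BaseChange.finrank_eigenlineOf_of_line` (the eigenline of a number-field
line is a line; Deligne LNM 900 Ex. 3.7), «`M_μ` is a number field» (l. 1928) being the tree THEOREM
`Thm418Data.numberField_fieldOfValues` (`Thm418ValueField.lean`); (iii) `injective_J` (given `[Module.Finite ℚ L]`) — by the tree's
`Thm418Data.injective_map43_of_eigenPullback` (`Liu2021/Map43Injective.lean`, tr-prover-6: linear algebra from `rank_L`, faithfulness,
`α`, `ι`); and **`map43AsPrinted : Map43AsPrinted M.toMap43Data`** (given `[Module.Finite ℚ L]`), with the CERTIFICATE `resW_mem_span_of_fixed`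
(the tree's Δ2 bridge whose only cite binder is then `Thm418AsPrinted D`).  So the Δ2 bridge's binders
`J` / `hJ` / `hJinj` (`Thm418CombinedReading.lean`) are instantiated by theorems whose cite class is: printed DEFINITIONS read on the
carriers + linear algebra — no comparison theorem Betti/étale, no [Fal83], no clause of the printed PROOF assumed.  Non-vacuity (kernel
consistency of the binder list; degenerate, says nothing about Liu's real objects): `nonempty_map43RationalData` (any datum with
`Ω(μ) = 0`) and `exists_map43RationalData` (unconditional, over every CM extension `E/F`).
PROVENANCE of the method: s2crux-idea-1 (L-GEO) `RouteJ-Sketch.lean` / `Map43Rational-kit.lean` (E3)–(E5), tr-prover-6's independent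
`Map43Injective`; lead gen 8 rulings HOME/INBOX l. 5715 (1)(c), l. 5740 (1).  HC_CM is NOT proved; this file discharges no COR-CM
binder (it changes the cite class of the Δ2 reading inputs).

## References
* [Liu2021] Y. Liu, Camb. J. Math. 9 (2021) = arXiv:2102.11518 — l. 650; Lem. 2.4 (1) (l. 1210–1213); Def. 4.5 (2) (l. 1944–1960);
  Def. 4.16, Rem. 4.17 (l. 2218–2228); §4.1 l. 1928; §4.2 l. 2070–2081; Thm. 4.18 and its proof (l. 2232–2270).
* [Deligne1982HodgeCycles] P. Deligne, *Hodge cycles on abelian varieties*, LNM 900 (1982), I Example 3.7, §4.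
-/

noncomputable section

open scoped TensorProduct
open NumberField TensorProduct

namespace Literature.NumberTheory.Automorphic.Liu2021

namespace Thm418Data

variable {F E : Type} [Field F] [NumberField F] [IsTotallyReal F] [Field E] [NumberField E] [Algebra F E]
  [IsTotallyComplex E] [Algebra.IsQuadraticExtension F E]

/-- The objects of the proof of [Liu2021, Thm. 4.18] over RATIONAL Betti carriers (see module docstring).  The `attribute [instance]`
line after the structure registers ONLY the structure's own bracketed carrier-instance fields (the additive-group / module structures of
`U`, `HB`, `L`), exactly as `Thm418Data` (`Thm418AsPrinted.lean`) and `Map43Data` (`Thm418ProofMapAsPrinted.lean`) do; it overrides no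
library instance (reviewer of p309893, point 3).
[cite: Liu2021, proof of Thm. 4.18 (FJcycle.tex l. 2247–2253); §4.2 l. 2070–2081; Def. 4.5 (2); l. 650] -/
structure Map43RationalData (D : Thm418Data F E) : Type 1 where
  /-- «Take an arbitrary object `D_μ ∈ 𝒜(μ)`» (l. 2248). -/
  Dμ : D.Obj
  /-- «Take an embedding `τ' : E → ℂ` …» (l. 2250). -/
  τ' : E →+* ℂ
  /-- «… in `Φ_μ`» (l. 2250). -/
  τ'_mem : τ' ∈ D.cmType.1
  /-- ⟨CARRIER⟩ `H¹_{B,τ'}(A_∞, ℚ) := colim_K H¹_{B,τ'}(A_K, ℚ)` (rational Betti cohomology of the pro-object `A_∞`, l. 2070–2079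
  with `ℚ`-coefficients as in Lem. 2.4 (1)). -/
  U : Type
  [instAddCommGroupU : AddCommGroup U]
  [instModuleU : Module ℚ U]
  /-- ⟨CARRIER⟩ the Hecke action of `𝔾(𝔸_F^∞)` on `H¹_{B,τ'}(A_∞, ℚ)` (l. 2074, defined over `ℚ`). -/
  ρU : Representation ℚ D.G U
  /-- ⟨CARRIER⟩ the consumer's complex carrier `H¹_{B,τ'}(A_∞, ℂ)` (l. 2079). -/
  HB : Type
  [instAddCommGroupHB : AddCommGroup HB]
  [instModuleHB : Module ℂ HB]
  /-- ⟨CARRIER⟩ the action of `𝔾(𝔸_F^∞)` on `H¹_{B,τ'}(A_∞, ℂ)` (l. 2081). -/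
  ρB : Representation ℂ D.G HB
  /-- ⟨CARRIER⟩ the comparison `ℂ ⊗_ℚ H¹_{B,τ'}(A_∞, ℚ) → H¹_{B,τ'}(A_∞, ℂ)` (universal coefficients). -/
  ι : ℂ ⊗[ℚ] U →ₗ[ℂ] HB
  /-- ⟨CARRIER LAW⟩ the comparison is injective (it is an isomorphism; injectivity is what is used). -/
  ι_injective : Function.Injective ι
  /-- ⟨CARRIER LAW⟩ the Hecke action is defined over `ℚ` (indeed over `E`: «the Hecke correspondences provide a homomorphism
  `𝔾(𝔸_F^∞) → Aut_E(A_∞)`», l. 2074; functoriality of Betti `H¹` under these `E`-morphisms, cf. [Del79] 2.1.4 / 2.2.5 for the model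
  side): the comparison intertwines `ρU ⊗ ℂ` and `ρB`. -/
  ι_comm : ∀ (g : D.G) (x : ℂ ⊗[ℚ] U), ι ((ρU g).baseChange ℂ x) = ρB g (ι x)
  /-- ⟨CARRIER⟩ `H¹_{B,τ'}(A_μ, ℚ)` … -/
  L : Type
  [instAddCommGroupL : AddCommGroup L]
  [instModuleRatL : Module ℚ L]
  /-- … as a module over `M_μ` through `i_μ : M_μ → End_E(A_μ)_ℚ` (Def. 4.5 (2), l. 1948) and functoriality of `H¹`. -/
  [instModuleL : Module (fieldOfValues E D.μ) L]
  [instTowerL : IsScalarTower ℚ (fieldOfValues E D.μ) L]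
  /-- ⟨CARRIER LAW⟩ «`A_μ` has dimension `[M_μ:ℚ]/2`» (l. 650) with the CM structure `i_μ` (Def. 4.5 (2)): `H¹_{B,τ'}(A_μ, ℚ)` is
  free of rank one over `M_μ`. -/
  rank_L : Module.finrank (fieldOfValues E D.μ) L = 1
  /-- «We choose a basis `α` of this subspace» (l. 2250): the chosen vector of `ℂ ⊗_ℚ H¹_{B,τ'}(A_μ, ℚ) = H¹_{B,τ'}(A_μ, ℂ)` … -/
  α : ℂ ⊗[ℚ] L
  /-- … on which `M_μ` acts via the inclusion `M_μ ↪ ℂ` … -/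
  α_mem : ∀ m : fieldOfValues E D.μ,
    (DistribSMul.toLinearMap ℚ L m).baseChange ℂ α = algebraMap (fieldOfValues E D.μ) ℂ m • α
  /-- … and non-zero. -/
  α_ne : α ≠ 0
  /-- ⟨CARRIER⟩ `f ↦ f^*` on RATIONAL classes: `Ω(μ) = Hom_E(A_∞, A_μ)_ℚ → Hom_ℚ(H¹_{B,τ'}(A_μ, ℚ), H¹_{B,τ'}(A_∞, ℚ))`
  (Rem. 4.17 at `D_μ`, l. 2248; «by pulling back», l. 2250), additive. -/
  P : D.Ω →+ (L →ₗ[ℚ] U)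
  /-- ⟨CARRIER LAW⟩ «`M_μ` acts via `i_μ`» (l. 2219): `(i_μ(m) ∘ f)^* = f^* ∘ i_μ(m)^*`. -/
  P_smul : ∀ (m : fieldOfValues E D.μ) (f : D.Ω), P (m • f) = P f ∘ₗ DistribSMul.toLinearMap ℚ L m
  /-- ⟨CARRIER LAW⟩ both actions of `𝔾(𝔸_F^∞)` — on `Ω(μ) = Hom_E(A_∞, A_μ)_ℚ` («acts `M_μ`-linearly via its action on `A_∞`»,
  l. 2219) and on `H¹_{B,τ'}(A_∞, ℚ)` (l. 2074–2081) — are induced by the ONE homomorphism `𝔾(𝔸_F^∞) → Aut_E(A_∞)` (l. 2074), so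
  pull-back intertwines them: `(g · f)^* = g · f^*`.  This is the coherence law «which is `ℂ[𝔾(𝔸_F^∞)]`-linear» (l. 2250) rests
  on; at instantiation it is functoriality of `H¹` under Hecke translation on the consumer's model ([Del79] 2.1.4 / 2.2.5). -/
  P_comm : ∀ (g : D.G) (f : D.Ω), P (D.rhoΩ g f) = (ρU g) ∘ₗ P f
  /-- ⟨CARRIER LAW⟩ faithfulness: `f ↦ f^*` is injective on `Ω(μ) = Hom_E(A_∞, A_μ)_ℚ = colim_K Hom_E(A_K, A_μ)_ℚ` — level-wise
  faithfulness of rational Betti `H¹` on `Hom ⊗ ℚ` of abelian varieties (tree `AbelianVariety.hom_eq_of_complexBetti_map_one_eq`)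
  together with injectivity of the transition pull-backs `H¹(A_K; ℚ) → H¹(A_{K'}; ℚ)` along the surjections `A_{K'} → A_K`; used
  only by the discharge of clause (iii) (tree `Liu2021/Map43Injective.lean`). -/
  P_injective : Function.Injective P

attribute [instance] Map43RationalData.instAddCommGroupU Map43RationalData.instModuleU
  Map43RationalData.instAddCommGroupHB Map43RationalData.instModuleHB Map43RationalData.instAddCommGroupL
  Map43RationalData.instModuleRatL Map43RationalData.instModuleL Map43RationalData.instTowerL

namespace Map43RationalData

variable {D : Thm418Data F E} (M : D.Map43RationalData)

/-- `i_μ(m)^*` on `H¹_{B,τ'}(A_μ, ℂ) = ℂ ⊗_ℚ H¹_{B,τ'}(A_μ, ℚ)`: the base change of `m • ·`.  DEFINED.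
[cite: Liu2021, proof of Thm. 4.18 (l. 2250)] -/
def iB (m : fieldOfValues E D.μ) : Module.End ℂ (ℂ ⊗[ℚ] M.L) :=
  (DistribSMul.toLinearMap ℚ M.L m).baseChange ℂ

/-- `f^*` on complex classes, landing in the consumer's carrier: `ι ∘ (f^* ⊗ ℂ)`.  DEFINED. [cite: Liu2021, proof of Thm. 4.18 (l. 2250)] -/
def pull (f : D.Ω) : ℂ ⊗[ℚ] M.L →ₗ[ℂ] M.HB :=
  M.ι ∘ₗ (M.P f).baseChange ℂ

/-- Additivity of `pull` in `f ∈ Ω(μ) = Hom_E(A_∞, A_μ)_ℚ` (from additivity of `P`). [cite: Liu2021, Def. 4.16 (l. 2219)] -/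
theorem pull_add (f f' : D.Ω) : M.pull (f + f') = M.pull f + M.pull f' := by
  simp only [pull, map_add, LinearMap.baseChange_add, LinearMap.comp_add]

/-- `M_μ`-compatibility of `pull`: «`M_μ` acts via `i_μ`» (from `P_smul`). [cite: Liu2021, Def. 4.16 (l. 2219)] -/
theorem pull_smul (m : fieldOfValues E D.μ) (f : D.Ω) : M.pull (m • f) = M.pull f ∘ₗ M.iB m := by
  simp only [pull, iB, M.P_smul, LinearMap.baseChange_comp, LinearMap.comp_assoc]

/-- **The rational record yields the bare-`ℂ` record of `Thm418ProofMapAsPrinted`** (`H¹_{B,τ'}(A_μ, ℂ) := ℂ ⊗_ℚ H¹_{B,τ'}(A_μ, ℚ)`,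
`iB m := (m • ·) ⊗ ℂ`, `pull f := ι ∘ (f^* ⊗ ℂ)`).  DEFINED as an `abbrev` (reducible), so that instance synthesis on the
consumer's carrier sees `M.toMap43Data.HB = M.HB` (e.g. a `ℂ[𝔾(𝔸_F^∞)]`-module structure on `M.HB`; tr-prover-6, HOME/INBOX l. 5852).
[cite: Liu2021, proof of Thm. 4.18 (l. 2247–2253)] -/
abbrev toMap43Data : D.Map43Data where
  Dμ := M.Dμ
  τ' := M.τ'
  τ'_mem := M.τ'_mem
  HB := M.HB
  ρB := M.ρB
  HBμ := ℂ ⊗[ℚ] M.L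
  iB :=
    { toFun := M.iB
      map_one' := by
        ext x
        simp [iB]
      map_mul' := fun m m' => by
        ext x
        simp [iB, mul_smul]
      map_zero' := by
        ext x
        simp [iB]
      map_add' := fun m m' => by
        ext x
        simp [iB, add_smul, TensorProduct.tmul_add] }
  α := M.α
  α_mem := M.α_mem
  α_ne := M.α_ne
  pull := M.pull
  pull_add := M.pull_add
  pull_smul := M.pull_smul

/-- (4.3) of the rational record is (4.3) of the induced bare-`ℂ` record: `J (z ⊗ f) = ι (z • (f^* ⊗ ℂ) α)` — the shape consumed by
the tree's injectivity theorem (`Liu2021/Map43Injective.lean`). [cite: Liu2021, proof of Thm. 4.18, (4.3) (l. 2250–2258)] -/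
theorem J_tmul (z : ℂ) (f : D.Ω) :
    M.toMap43Data.J (z ⊗ₜ[fieldOfValues E D.μ] f) = M.ι (z • (M.P f).baseChange ℂ M.α) := by
  rw [Map43Data.J_tmul]
  show z • (M.ι ∘ₗ (M.P f).baseChange ℂ) M.α = _
  rw [LinearMap.comp_apply, map_smul]

/-- **Clause (ii) is a THEOREM over rational carriers**: `f ↦ f^*α` is `𝔾(𝔸_F^∞)`-equivariant (from `P_comm` and `ι_comm`).
[cite: Liu2021, proof of Thm. 4.18 (l. 2250)] -/
theorem pb_rhoΩ (g : D.G) (f : D.Ω) :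
    M.toMap43Data.pb (D.rhoΩ g f) = M.toMap43Data.ρB g (M.toMap43Data.pb f) := by
  show (M.ι ∘ₗ (M.P (D.rhoΩ g f)).baseChange ℂ) M.α = M.ρB g ((M.ι ∘ₗ (M.P f).baseChange ℂ) M.α)
  rw [M.P_comm, LinearMap.baseChange_comp, LinearMap.comp_apply, LinearMap.comp_apply, LinearMap.comp_apply, M.ι_comm]

/-- **`hJ` BY NAME, hypothesis-free over rational carriers**: (4.3) is `𝔾(𝔸_F^∞)`-equivariant on all of `Ω(μ) ⊗_{M_μ} ℂ`
(clause (ii) on pure tensors + `ℂ`-linearity; no finiteness needed). [cite: Liu2021, proof of Thm. 4.18 (l. 2250–2253)] -/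
theorem hJ (g : D.G) (x : ℂ ⊗[fieldOfValues E D.μ] D.Ω) :
    M.toMap43Data.J ((D.rhoΩ g).baseChange ℂ x) = M.toMap43Data.ρB g (M.toMap43Data.J x) := by
  induction x using TensorProduct.induction_on with
  | zero => simp only [map_zero]
  | tmul z f =>
    rw [LinearMap.baseChange_tmul, Map43Data.J_tmul, Map43Data.J_tmul, map_smul, ← Map43Data.pb_apply,
      ← Map43Data.pb_apply, M.pb_rhoΩ]
  | add x y hx hy => simp only [map_add, hx, hy]

/-- Over rational carriers the as-printed predicate reduces to its clauses (i) and (iii).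
[cite: Liu2021, proof of Thm. 4.18 (l. 2247–2268)] -/
theorem map43AsPrinted_iff :
    Map43AsPrinted M.toMap43Data ↔
      Module.finrank ℂ M.toMap43Data.eigenline = 1 ∧ Function.Injective M.toMap43Data.J :=
  ⟨fun h => ⟨h.1, h.2.2⟩, fun h => ⟨h.1, M.pb_rhoΩ, h.2⟩⟩

/-! ### Clause (i) is a THEOREM over rational carriers -/

/-- **Clause (i) «the maximal subspace … has dimension `1`» is a THEOREM over rational carriers**: the `M_μ`-eigenline of
`H¹_{B,τ'}(A_μ, ℂ) = ℂ ⊗_ℚ H¹_{B,τ'}(A_μ, ℚ)` is a line, because `H¹_{B,τ'}(A_μ, ℚ)` is an `M_μ`-line (`rank_L`, l. 650) and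
`M_μ` is a number field (tree THEOREM `Thm418Data.numberField_fieldOfValues`, `Thm418ValueField.lean`; l. 1928) — tree
`Literature.LinearAlgebra.BaseChange.finrank_eigenlineOf_of_line` (Deligne LNM 900 Ex. 3.7).  No finiteness hypothesis on `L`.
[cite: Liu2021, proof of Thm. 4.18 (l. 2250)] -/
theorem finrank_eigenline_eq_one : Module.finrank ℂ M.toMap43Data.eigenline = 1 := by
  haveI : NumberField (fieldOfValues E D.μ) := D.numberField_fieldOfValues
  have hset : M.toMap43Data.eigenline =
      Literature.LinearAlgebra.BaseChange.eigenlineOf (fieldOfValues E D.μ) M.L := by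
    ext β
    rw [Map43Data.mem_eigenline_iff]
    exact Iff.rfl
  rw [hset]
  exact Literature.LinearAlgebra.BaseChange.finrank_eigenlineOf_of_line (M := fieldOfValues E D.μ) M.L M.rank_L

/-! ### Clause (iii) is a THEOREM over rational carriers (tree `Liu2021/Map43Injective.lean`, tr-prover-6) -/

/-- Pointwise form of the law `P_smul`: `(m • f)^* ℓ = f^*(m • ℓ)`. [cite: Liu2021, Def. 4.16 (l. 2219)] -/
theorem P_smul_apply (m : fieldOfValues E D.μ) (f : D.Ω) (l : M.L) : M.P (m • f) l = M.P f (m • l) := by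
  rw [M.P_smul, LinearMap.comp_apply, DistribSMul.toLinearMap_apply]

/-- **Clause (iii) «(4.3) is injective» is a THEOREM over rational carriers**: by the tree's
`Thm418Data.injective_map43_of_eigenPullback` (`Liu2021/Map43Injective.lean`: faithfulness of `f ↦ f^*`, `H¹_{B,τ'}(A_μ, ℚ)` an
`M_μ`-line, `α ≠ 0` an eigenvector, an injective comparison `ι` — linear algebra; no comparison Betti/étale, no [Fal83]).
[cite: Liu2021, proof of Thm. 4.18, (4.3) (l. 2250–2268)] -/
theorem injective_J [Module.Finite ℚ M.L] : Function.Injective M.toMap43Data.J :=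
  injective_map43_of_eigenPullback M.rank_L M.P M.P_smul_apply M.P_injective M.α M.α_ne M.α_mem M.ι M.ι_injective
    M.toMap43Data.J M.J_tmul

/-- **[Liu2021, proof of Thm. 4.18 — the assertions (i)(ii)(iii) about the map (4.3)] HOLD over rational carriers** (given
`H¹_{B,τ'}(A_μ, ℚ)` finite-dimensional): the as-printed predicate `Map43AsPrinted` of `Thm418ProofMapAsPrinted.lean` for the
induced bare-`ℂ` record is a THEOREM — (i) `finrank_eigenline_eq_one`, (ii) `pb_rhoΩ`, (iii) `injective_J`.  Cite class:
printed DEFINITIONS read on the carriers (`rank_L` = Def. 4.5 (2) + l. 650; faithfulness; comparison) + linear algebra.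
HC_CM is NOT proved. [cite: Liu2021, proof of Thm. 4.18 (l. 2247–2268)] -/
theorem map43AsPrinted [Module.Finite ℚ M.L] : Map43AsPrinted M.toMap43Data :=
  ⟨M.finrank_eigenline_eq_one, M.pb_rhoΩ, M.injective_J⟩

/-- **CERTIFICATE over rational carriers — the Δ2 bridge needs only the printed STATEMENT of Thm. 4.18.**  The tree's
`Thm418Data.resW_mem_span_of_fixed_of_thm418AsPrinted` (`Thm418CombinedReading.lean`) with `J` / `hJ` / `hJinj` instantiated by the
THEOREMS of this file: hypotheses = the cite `Thm418AsPrinted D`, the rational carriers `M`, `H¹_{B,τ'}(A_μ, ℚ)` finite-dimensional, the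
consumer's level system and geometric side, and the class identification `hpin` on Liu's class «`φ^*α`» = `ι ((φ^* ⊗ ℂ) α)`.
No clause of the printed PROOF is a hypothesis.  HC_CM is NOT proved; no COR-CM binder is discharged here.
[cite: Liu2021, Thm. 4.18 (1) (l. 2239) with its proof, (4.3) (l. 2247–2268)] -/
theorem resW_mem_span_of_fixed [Module.Finite ℚ M.L] (h418 : Liu2021.Thm418AsPrinted D)
    {Lvl : Type*} [Preorder Lvl] (Kof : Lvl → Subgroup D.G)
    (hmono : ∀ ⦃K K' : Lvl⦄, K ≤ K' → Kof K ≤ Kof K') (hoc : ∀ K : Lvl, IsOpenCompact (Kof K))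
    (hcof : ∀ K' : Subgroup D.G, IsOpenCompact K' → ∃ K₀ : Lvl, Kof K₀ ≤ K')
    {W : Lvl → Type*} [∀ K, AddCommGroup (W K)] [∀ K, Module ℂ (W K)]
    (resW : ∀ K : Lvl, M.HB →ₗ[ℂ] W K) (cmCl : ∀ K : Lvl, Set (W K))
    (hpin : ∀ (K : Lvl) (φ : D.HomK (Kof K) M.Dμ),
      resW K (M.ι (((M.P (D.res (Kof K) M.Dμ φ)).baseChange ℂ) M.α)) ∈ cmCl K) :
    ∃ K₀ : Lvl, ∀ K ≤ K₀, ∀ x : ℂ ⊗[fieldOfValues E D.μ] D.Ω,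
      (∀ k ∈ Kof K, M.ρB k (M.toMap43Data.J x) = M.toMap43Data.J x) →
        resW K (M.toMap43Data.J x) ∈ Submodule.span ℂ (cmCl K) :=
  Map43Data.resW_mem_span_of_fixed_of_asPrinted h418 M.map43AsPrinted Kof hmono hoc hcof resW cmCl fun K φ => hpin K φ

end Map43RationalData

/-- **The binder list `Map43RationalData D` is inhabited** over every datum `D` whose `Ω(μ)` is trivial, for any object `D_μ` and any
`τ' ∈ Φ_μ` (degenerate carriers: `U := 0`, `H := 0`, `L := M_μ` itself with `rank_L = 1`, `P := 0`; the eigenvector `α` EXISTS because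
`M_μ` is a number field — tree THEOREM `Thm418Data.numberField_fieldOfValues` — by
`Literature.LinearAlgebra.BaseChange.exists_mem_eigenlineOf_ne_zero`).  Bookkeeping (kernel consistency of the binder list, as the
referee of p306391 notes for M2's witness: it says nothing about non-vacuity at Liu's real objects).
[cite: Liu2021, §4.1 l. 1928; proof of Thm. 4.18 (l. 2250)] -/
theorem nonempty_map43RationalData (D : Thm418Data F E) [Subsingleton D.Ω]
    (Dμ : D.Obj) {τ' : E →+* ℂ} (hτ' : τ' ∈ D.cmType.1) : Nonempty D.Map43RationalData := by
  haveI : NumberField (fieldOfValues E D.μ) := D.numberField_fieldOfValues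
  obtain ⟨α, hα, hα0⟩ := Literature.LinearAlgebra.BaseChange.exists_mem_eigenlineOf_ne_zero (M := fieldOfValues E D.μ)
    (fieldOfValues E D.μ) (Module.finrank_self _)
  have hx : ∀ w : ℂ ⊗[ℚ] PUnit, w = 0 := fun w =>
    w.induction_on rfl (fun z p => by rw [Subsingleton.elim p 0, tmul_zero]) fun a b ha hb => by rw [ha, hb, add_zero]
  refine ⟨{ Dμ := Dμ, τ' := τ', τ'_mem := hτ', U := PUnit, ρU := 1, HB := PUnit, ρB := 1, ι := 0
            ι_injective := fun x y _ => by rw [hx x, hx y]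
            ι_comm := fun _ _ => by simp
            L := fieldOfValues E D.μ, rank_L := Module.finrank_self _, α := α
            α_mem := (Literature.LinearAlgebra.BaseChange.mem_eigenlineOf).1 hα, α_ne := hα0, P := 0
            P_smul := fun _ _ => by simp
            P_comm := fun _ _ => by simp
            P_injective := fun f f' _ => Subsingleton.elim f f' }⟩

/-- **Unconditional non-vacuity**: over every CM extension `E/F` as in l. 1878 SOME datum `D` (a REAL weight-one conjugate symplectic `μ`,
tree `IdeleClassGroup.exists_isConjugateSymplectic_hasCMType`; degenerate carriers, `Ω(μ) := 0`) carries a `Map43RationalData D` — the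
hypothesis list of this file's theorems is jointly satisfiable (kernel consistency; degenerate, says nothing about Liu's objects).
[cite: Liu2021, proof of Thm. 4.18 (l. 2247–2253)] -/
theorem exists_map43RationalData (F E : Type) [Field F] [NumberField F] [IsTotallyReal F] [Field E] [NumberField E] [Algebra F E]
    [IsTotallyComplex E] [Algebra.IsQuadraticExtension F E] :
    ∃ D : Thm418Data F E, Nonempty D.Map43RationalData := by
  classical
  letI : IsCMField E := isCMField F E
  obtain ⟨μ, hμ, hw, -⟩ := IdeleClassGroup.exists_isConjugateSymplectic_hasCMType (L := E)
    (IdeleClassGroup.cmTypeOf E (fun _ => -1) (by simp))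
  obtain ⟨τ', hτ'⟩ : ∃ τ' : E →+* ℂ, τ' ∈ hμ.cmType.1 := by
    let φ : E →+* ℂ := Classical.arbitrary (E →+* ℂ)
    by_cases hφ : φ ∈ hμ.cmType.1
    · exact ⟨φ, hφ⟩
    · exact ⟨ComplexEmbedding.conjugate φ, Classical.not_not.1 fun h => hφ ((hμ.cmType.2 φ).2 h)⟩
  let D : Thm418Data F E := ⟨2, le_rfl, PUnit, PUnit, PUnit, fun _ => PUnit.unit, PUnit, μ, hμ, hw, PUnit, fun _ _ => PUnit,
    fun _ _ => 1, PUnit, 1, fun _ _ => PUnit, fun _ _ => 0⟩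
  exact ⟨D, nonempty_map43RationalData D PUnit.unit hτ'⟩

end Thm418Data

end Literature.NumberTheory.Automorphic.Liu2021

end
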